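/-
Copyright (c) 2026 the pub-hodgecm-mathlib formalisation cell (harness21).  Prover seat hodgecm-mathlib-F0P3a-p01 (g34), req620 Track A «(D-RAM) FOUR-FRAME» squad, unit U2H:
the (ρ2b′-X) child (U2H ED. 15 :418) — SOCKET (C) (type RamM) organ (C-5b) Σ3b «THE SYMBOL (β, θ)_v READS THE NORM CLASS OF THE S9 ELEMENT» ((C) lead LH4-p04 (g5) LINE #15 «Σ3»;
the RamM twin of LH4-p13 (g6)'s ★ F3 `OrderCountCensusRamKSymbol` tail, whose E-side organs are reused verbatim).  2026-09-04.
-/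
import Summits.HodgeConjecture.HodgeConjecture.Theorems.F0P3cDyRamOrderCountCensusRamKNormaliser   -- ★ (LH4-p13): `exists_normOne_sqrt_det`; brings ★ p857924 `TokenSignDepthSymbol`, ★ p857819 `TokenSignRamK`, ★ p857454 `TokenSignUnr`
import HarnessLib

/-!
# Crux `H413`, line LH4 «(D-RAM) FOUR-FRAME» road — unit U2H, (ρ2b′-X), SOCKET (C): `(β, θ)_v = 1 ⟺ N_{K♮∕F}(κ_S9) ∈ N_{E∕F}(E)` AT THE CM PLACE, TYPE RamM (Σ3b)

Cell `hodgecm-mathlib` (D-0151), FLOOR 0, crux item H413 = `stmt-HodgeConjecture-24833`, route of record `HCCMUnconditional`; squad F0∕P3c∕LH4; registered stub served: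
`F0P3cDyRamFourFrameU2H.stub_U2H_fixedPointCensus_typeTwo_unit0` ((ρ2b′-X), U2H ED. 15 :418) through the typed bottom socket (C) `SOCKET-hOCC.v1` (869d0c15; type RamM).
LETTERS: the CM place `w ∣ v` of `L ∕ L⁺` (`σ_w`, `ι = toPlace v w`, `θ = cmQuadraticGenerator L`), its ramified datum `(σ_w, ϖ, d, tE)` and the dyadic letter `|2|_w < 1`; an
abstract field `M` with `jE : L_w →+* M` RAMIFIED — **`|jE a| = |a|²`** (type RamM; socket (C): `M := E′_{w₁}`, `jE := toPlace w.1 w₁`), commuting involutions `ρ` (isometric,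
`Fix ρ = jE(L_w)`) and `Θ` (`Θ ∘ jE = jE ∘ σ_w`); the eigen-letters (`Θλ·λ = 1`, `λ² = jE tr·λ − jE D`, `ρλ = jE tr − λ`, `x² − tr x + D` rootless in `L_w`, `D·σD = 1`); the `U(1)`
scalar `u₀` (`σu₀·u₀ = 1`); the token `|λ − jE u₀|_M = exp(−2m)` with ONE depth letter `2d + 3tE + 1 ≤ m`; the symmetrised discriminant `β ∈ L⁺_v`, `ι β = −χ(u₀² + D)∕(2u₀²D)`,
`χ = u₀² − tr·u₀ + D`.
WHAT IS PROVED (`hilbertSymbol_eq_one_iff_exists_rhoNorm_signKappa_ramM`): there are a NORMALISER `ν₀ ∈ L_w` (`ν₀² = D`, `σν₀·ν₀ = 1`; ★ `exists_normOne_sqrt_det`) and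
`s ∈ L_w` (`s ≠ 0`, `σs = −s`, `s² = ι θ`; ★ `exists_antifixed_sq_eq_toPlace_cmQuadraticGenerator`) such that, with `ν := jE ν₀`, `λ′ := λ∕ν`, `u′ := jE u₀∕ν`, `ω := jE s` and
the S9 element **`κ := (λ′ − u′)(1 + λ′)(1 + u′)∕(ω·λ′·u′)`** (★ p857819, `Θκ = κ`): `ρν = ν`, `ν·Θν = 1`, `λ·ρλ = ν²`, `ρω = ω`, `Θω = −ω`, `ω ≠ 0`, `|λ′ − 1| ≤ exp(−2(m − tE))`,
`1 + λ′ ≠ 0`, `1 + u′ ≠ 0`, `λ′ − u′ ≠ 0`, and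
**`(β, θ)_v = 1 ⟺ ∃ e, ρe = e ∧ e·Θe = κ·ρκ`** — the RamM twin of ★ F3's tail: `κρκ = jE(ι N)` with `(N, θ)_v = 1 ⟺ κρκ ∈ N_{E∕F}` (★ `hilbertSymbol_eq_one_iff_exists_norm_toPlace`),
`(β, θ)_v = (x, θ)_v` (★ p857924, E-side, type-free), `x·N₁·N₂ = −θ·N` (★ p857819 §2), `(N₂, θ)_v = 1` (a norm), `(N₁, θ)_v = 1` (`|ι(N₁∕4) − 1|_w ≤ |ϖ|^{m − 3tE}` — the square
root of the M-side depth, since `|jE a| = |a|²`).  Σ3a ★∕cand `F0P3cDyRamSignFarCellRamM` turns the far-cell class bits into the right-hand side; Σ3c assembles.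
THEOREMS ONLY (no `def`, no instance, no notation, no `sorry`); lane `--supports stmt-HodgeConjecture-24833 --as helper` (count-neutral).
HONEST LABEL.  Count-neutral helper; (ρ2b′-X) stays an OPEN prover target; `HC_CM` is proved only modulo the 7 printed citations (2 remaining named inputs: hLiu418 =
`stmt-HodgeConjecture-24832`, h413 = `stmt-HodgeConjecture-24833`) until rung 0 closes.

## References
* [Rogawski1990] J. D. Rogawski, *Automorphic Representations of Unitary Groups in Three Variables*, Ann. of Math. Stud. 123 (1990), §4.9 Prop. 4.9.1 (b) p. 55, Lemma 4.9.3 p. 56.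
* [LabesseLanglands1979] J.-P. Labesse, R. P. Langlands, *L-indistinguishability for SL(2)*, Canad. J. Math. 31 (1979), §2 (2.1)–(2.2) pp. 7–8.
* [Serre1979] J.-P. Serre, *Local Fields*, GTM 67 (1979), Ch. V §3 Cor. 3; Ch. XIV §§3–4 (Hensel, local symbols).
-/

set_option autoImplicit false

noncomputable section

open NumberField IsDedekindDomain WithZero IsLocalRing
open Literature.NumberTheory.Automorphic Literature.NumberTheory.Automorphic.UnitaryGroup Literature.NumberTheory.GaloisRepresentations
open Literature.NumberTheory.QuadraticForms Literature.NumberTheory.Rogawski1990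
open Literature.NumberTheory.Automorphic.UnitaryThreeFourFrame
open scoped Valued

namespace Summit.HodgeConjecture.HodgeConjecture.Cruxes.H413.F0P3cDyRamSignSymbolRamM

open Literature.NumberTheory.LocalFields.WildQuadraticDatum (v_varpi_pow)
open Summit.HodgeConjecture.HodgeConjecture.Cruxes.H413.F0P3cDyRamTokenSignUnr (exists_antifixed_sq_eq_toPlace_cmQuadraticGenerator exists_toPlace_eq_of_fixed
  hilbertSymbol_eq_one_of_valued_toPlace_sub_one_le)
open Summit.HodgeConjecture.HodgeConjecture.Cruxes.H413.F0P3cDyRamTokenSignDepthSymbol (valued_eq_one_of_map_mul_self hilbertSymbol_token_eq_hilbertSymbol_depth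
  hilbertSymbol_eq_of_mul_mul_eq_neg_mul)
open Summit.HodgeConjecture.HodgeConjecture.Cruxes.H413.F0P3cDyRamTokenSignRamK (theta_map_signKappa traceDiff_mul_norms_eq_neg_sq_mul_norm_signKappa)
open Summit.HodgeConjecture.HodgeConjecture.Cruxes.H413.F0P3cDyRamSideNormCriterionRamK (two_le_of_datum_of_v_two_lt_one)
open Summit.HodgeConjecture.HodgeConjecture.Cruxes.H413.F0P3cDyRamOrderCountCensusRamKNormaliser (exists_normOne_sqrt_det)

/-! ## §0 Square roots of valuations (`|jE a| = |a|²` bookkeeping) -/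

/-- `a·a ≤ exp(2k) ⇒ a ≤ exp k` in `ℤᵐ⁰`. [cite: Serre1979, Ch. XIV §4] -/
theorem le_exp_of_mul_self_le {a : ℤᵐ⁰} {k : ℤ} (h : a * a ≤ exp (2 * k)) : a ≤ exp k := by
  rcases eq_or_ne a 0 with h0 | h0
  · rw [h0]; exact zero_le
  rw [← exp_log h0] at h ⊢
  rw [← exp_add, exp_le_exp] at h
  rw [exp_le_exp]; omega

/-- `a < exp k ⇒ a·a < exp(2k)` in `ℤᵐ⁰`. [cite: Serre1979, Ch. XIV §4] -/
theorem mul_self_lt_exp_of_lt {a : ℤᵐ⁰} {k : ℤ} (h : a < exp k) : a * a < exp (2 * k) := by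
  rcases eq_or_ne a 0 with h0 | h0
  · rw [h0, mul_zero]; exact zero_lt_iff.2 (exp_ne_zero)
  rw [← exp_log h0] at h ⊢
  rw [exp_lt_exp] at h
  rw [← exp_add, exp_lt_exp]; omega

variable (L : Type) [Field L] [NumberField L] [IsCMField L] {v : HeightOneSpectrum (𝓞 ↥(maximalRealSubfield L))}
  (w : PlacesOver L v) (hw : IsCMField.complexConj L • w.1 = w.1)

/-! ## The theorem -/

include hw in
/-- **`(β, θ)_v = 1 ⟺ N_{K♮∕F}(κ_S9) ∈ N_{E∕F}(E)`, TYPE RamM**, with the normaliser `ν₀` and the anti-fixed `s` produced — see the module docstring for letters and route.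
[cite: Rogawski1990, §4.9 Prop. 4.9.1 (b) p. 55, Lemma 4.9.3 p. 56] [cite: LabesseLanglands1979, §2 (2.1)–(2.2) pp. 7–8] [cite: Serre1979, Ch. V §3 Cor. 3; Ch. XIV §§3–4] -/
theorem hilbertSymbol_eq_one_iff_exists_rhoNorm_signKappa_ramM
    (ϖ : w.1.adicCompletion L) (d tE : ℕ) (hD : IsRamifiedQuadraticDatum (galAdicCompletionMap (L := L) (IsCMField.complexConj L) hw) ϖ d tE)
    (h2v : Valued.v (2 : w.1.adicCompletion L) < 1)
    {M : Type} [Field M] [Valued M ℤᵐ⁰] (jE : w.1.adicCompletion L →+* M) (hjE2 : ∀ a, Valued.v (jE a) = Valued.v a ^ 2)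
    (ρ Θ : M →+* M) (hρρ : ∀ z, ρ (ρ z) = z) (hvρ : ∀ z, Valued.v (ρ z) = Valued.v z) (hΘρ : ∀ z, Θ (ρ z) = ρ (Θ z))
    (hΘΘ : ∀ z, Θ (Θ z) = z) (hvΘ : ∀ z, Valued.v (Θ z) = Valued.v z)
    (hjfix : ∀ z, ρ z = z ↔ ∃ a, jE a = z) (hΘj : ∀ a, Θ (jE a) = jE (galAdicCompletionMap (L := L) (IsCMField.complexConj L) hw a))
    {lam : M} {tr D : w.1.adicCompletion L} (hΘlam : Θ lam * lam = 1) (hlam2 : lam * lam = jE tr * lam - jE D) (hρlam : ρ lam = jE tr - lam)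
    (hirr : ∀ x : w.1.adicCompletion L, x * x - tr * x + D ≠ 0) (hDσ : D * galAdicCompletionMap (L := L) (IsCMField.complexConj L) hw D = 1)
    {u₀ : w.1.adicCompletion L} (hσu₀ : galAdicCompletionMap (L := L) (IsCMField.complexConj L) hw u₀ * u₀ = 1)
    {m : ℕ} (hm : Valued.v (lam - jE u₀) = exp (-(2 * (m : ℤ)))) (hm0 : 2 * d + 3 * tE + 1 ≤ m)
    (β : v.adicCompletion ↥(maximalRealSubfield L)) {χ : w.1.adicCompletion L} (hχ : χ = u₀ ^ 2 - tr * u₀ + D)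
    (hβ : toPlace v w β = -(χ * (u₀ ^ 2 + D)) / (2 * u₀ ^ 2 * D)) :
    ∃ ν₀ s : w.1.adicCompletion L, ν₀ * ν₀ = D ∧ galAdicCompletionMap (L := L) (IsCMField.complexConj L) hw ν₀ * ν₀ = 1 ∧
      s ≠ 0 ∧ galAdicCompletionMap (L := L) (IsCMField.complexConj L) hw s = -s ∧
      ρ (jE ν₀) = jE ν₀ ∧ jE ν₀ * Θ (jE ν₀) = 1 ∧ lam * ρ lam = jE ν₀ ^ 2 ∧ ρ (jE s) = jE s ∧ Θ (jE s) = -jE s ∧ jE s ≠ 0 ∧ jE ν₀ ≠ 0 ∧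
      Valued.v (lam / jE ν₀ - 1) ≤ exp (-(2 * ((m : ℤ) - tE))) ∧ 1 + lam / jE ν₀ ≠ 0 ∧ 1 + jE u₀ / jE ν₀ ≠ 0 ∧ lam / jE ν₀ - jE u₀ / jE ν₀ ≠ 0 ∧
      (hilbertSymbol (v.adicCompletion ↥(maximalRealSubfield L)) β
            (algebraMap ↥(maximalRealSubfield L) _ ((cmQuadraticGenerator L : 𝓞 ↥(maximalRealSubfield L)) : ↥(maximalRealSubfield L))) = 1 ↔
        ∃ e : M, ρ e = e ∧ e * Θ e =
          (lam / jE ν₀ - jE u₀ / jE ν₀) * (1 + lam / jE ν₀) * (1 + jE u₀ / jE ν₀) / (jE s * (lam / jE ν₀) * (jE u₀ / jE ν₀)) *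
            ρ ((lam / jE ν₀ - jE u₀ / jE ν₀) * (1 + lam / jE ν₀) * (1 + jE u₀ / jE ν₀) / (jE s * (lam / jE ν₀) * (jE u₀ / jE ν₀)))) := by
  classical
  haveI : CharZero (v.adicCompletion ↥(maximalRealSubfield L)) :=
    charZero_of_injective_algebraMap (algebraMap ↥(maximalRealSubfield L) (v.adicCompletion ↥(maximalRealSubfield L))).injective
  have hD' := hD
  obtain ⟨hσσ, hσv, hϖ, -, -, hd1, h2t⟩ := hD'
  obtain ⟨hd2, -, ht1⟩ := two_le_of_datum_of_v_two_lt_one hD h2v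
  set σ := galAdicCompletionMap (L := L) (IsCMField.complexConj L) hw with hσdef
  set θv : v.adicCompletion ↥(maximalRealSubfield L) :=
    algebraMap ↥(maximalRealSubfield L) _ ((cmQuadraticGenerator L : 𝓞 ↥(maximalRealSubfield L)) : ↥(maximalRealSubfield L)) with hθvdef
  have hθ0 : θv ≠ 0 := by
    rw [hθvdef, Ne, map_eq_zero_iff _ (algebraMap ↥(maximalRealSubfield L) (v.adicCompletion ↥(maximalRealSubfield L))).injective]
    exact fun h0 => not_isSquare_cmQuadraticGenerator L (by rw [h0]; exact IsSquare.zero)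
  have hπ : ∀ n : ℕ, Valued.v ϖ ^ n = exp (-(n : ℤ)) := v_varpi_pow hϖ
  rw [hπ] at h2t
  have hι : Function.Injective (toPlace v w) := (toPlace v w).injective
  have hjι : Function.Injective (fun y => jE (toPlace v w y)) := jE.injective.comp hι
  have hρΘ : ∀ z, ρ (Θ z) = Θ (ρ z) := fun z => (hΘρ z).symm
  -- ### M-side valuations through the RAMIFIED `jE`
  have hj2 : jE 2 = 2 := map_ofNat jE 2
  have h2Mt : Valued.v (2 : M) = exp (-(2 * (tE : ℤ))) := by
    rw [← hj2, hjE2, h2t, ← exp_nsmul, nsmul_eq_mul]; congr 1; ring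
  have h20M : (2 : M) ≠ 0 := fun h0 => by rw [h0, map_zero] at h2Mt; exact (exp_ne_zero h2Mt.symm).elim
  have hvu : Valued.v u₀ = 1 := valued_eq_one_of_map_mul_self L w hσv hσu₀
  have hu0 : u₀ ≠ 0 := fun h0 => by rw [h0, map_zero] at hvu; exact zero_ne_one hvu
  have hju0 : jE u₀ ≠ 0 := (map_ne_zero jE).2 hu0
  have hjvu : Valued.v (jE u₀) = 1 := by rw [hjE2, hvu, one_pow]
  have hρu : ρ (jE u₀) = jE u₀ := (hjfix _).2 ⟨u₀, rfl⟩
  have hu1 : jE u₀ * Θ (jE u₀) = 1 := by rw [hΘj, ← map_mul, mul_comm, hσu₀, map_one]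
  have hlam : lam * Θ lam = 1 := by rw [mul_comm]; exact hΘlam
  have hlam0 : lam ≠ 0 := fun h0 => by rw [h0, mul_zero] at hΘlam; exact zero_ne_one hΘlam
  have hμ0 : lam - jE u₀ ≠ 0 := fun h0 => by rw [h0, map_zero] at hm; exact (exp_ne_zero hm.symm).elim
  have hdet : lam * ρ lam = jE D := by rw [hρlam]; linear_combination -hlam2
  have hlamv : Valued.v lam = 1 := by
    have hlt : Valued.v (lam - jE u₀) < Valued.v (jE u₀) := by rw [hm, hjvu, ← exp_zero, exp_lt_exp]; omega
    have h := Valuation.map_add_eq_of_lt_left _ hlt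
    rwa [add_sub_cancel, hjvu] at h
  -- `|D − u₀²|_w ≤ exp(−m)` (the square root of the M-side bound `exp(−2m)`)
  have hDu : Valued.v (D - u₀ ^ 2) ≤ exp (-(m : ℤ)) := by
    apply le_exp_of_mul_self_le
    rw [← sq, ← hjE2, map_sub, map_pow, ← hdet,
      show lam * ρ lam - jE u₀ ^ 2 = (lam - jE u₀) * ρ lam + jE u₀ * ρ (lam - jE u₀) by rw [map_sub, hρu]; ring]
    refine (Valuation.map_add _ _ _).trans (max_le ?_ ?_)
    · rw [Valuation.map_mul, hm, hvρ, hlamv, mul_one, exp_le_exp]; omega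
    · rw [Valuation.map_mul, hjvu, one_mul, hvρ, hm, exp_le_exp]; omega
  -- ### the normaliser `ν₀` (E-side Hensel, ★ p13) and `ω := jE s`
  obtain ⟨ν₀, hνν, hσν, hν2, hν1⟩ := exists_normOne_sqrt_det L w hw hσv hσu₀ hDσ h2t (by omega) hDu
  have hvν : Valued.v ν₀ = 1 := valued_eq_one_of_map_mul_self L w hσv hσν
  have hν0 : ν₀ ≠ 0 := fun h0 => by rw [h0, map_zero] at hvν; exact zero_ne_one hvν
  have hjν0 : jE ν₀ ≠ 0 := (map_ne_zero jE).2 hν0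
  have hvν' : Valued.v (jE ν₀) = 1 := by rw [hjE2, hvν, one_pow]
  have hρν : ρ (jE ν₀) = jE ν₀ := (hjfix _).2 ⟨ν₀, rfl⟩
  have hνΘ : jE ν₀ * Θ (jE ν₀) = 1 := by rw [hΘj, ← map_mul, mul_comm, hσν, map_one]
  have hdetν : lam * ρ lam = jE ν₀ ^ 2 := by rw [hdet, ← map_pow, sq, hνν]
  obtain ⟨s, hs0, hσs, hs2⟩ := exists_antifixed_sq_eq_toPlace_cmQuadraticGenerator L w hw
  have hρω : ρ (jE s) = jE s := (hjfix _).2 ⟨s, rfl⟩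
  have hΘω : Θ (jE s) = -jE s := by rw [hΘj, hσs, map_neg]
  have hω0 : jE s ≠ 0 := (map_ne_zero jE).2 hs0
  -- ### primed letters and their valuations
  set lam' : M := lam / jE ν₀ with hlam'
  set u' : M := jE u₀ / jE ν₀ with hu'
  have hlamΘ' : lam' * Θ lam' = 1 := by rw [hlam', map_div₀, div_mul_div_comm, hlam, hνΘ, div_one]
  have hlamρ' : lam' * ρ lam' = 1 := by
    rw [hlam', map_div₀, hρν, div_mul_div_comm, hdetν, sq, div_self (mul_ne_zero hjν0 hjν0)]
  have hρu' : ρ u' = u' := by rw [hu', map_div₀, hρu, hρν]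
  have hu1' : u' * Θ u' = 1 := by rw [hu', map_div₀, div_mul_div_comm, hu1, hνΘ, div_one]
  have hlam'1 : Valued.v (lam' - 1) ≤ exp (-(2 * ((m : ℤ) - tE))) := by
    rw [hlam', show lam / jE ν₀ - 1 = (lam - jE ν₀) / jE ν₀ by field_simp, map_div₀, hvν', div_one,
      show lam - jE ν₀ = (lam - jE u₀) + jE (u₀ - ν₀) by rw [map_sub]; ring]
    refine (Valuation.map_add _ _ _).trans (max_le ?_ ?_)
    · rw [hm, exp_le_exp]; omega
    · rw [hjE2, sq]
      have h1 := mul_self_lt_exp_of_lt (k := -((m : ℤ) - tE) + 1) (hν1.trans_lt (by rw [exp_lt_exp]; omega))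
      have h2 : Valued.v (u₀ - ν₀) * Valued.v (u₀ - ν₀) ≤ exp (-((m : ℤ) - tE)) * exp (-((m : ℤ) - tE)) :=
        mul_le_mul' hν1 hν1
      refine h2.trans_eq ?_
      rw [← exp_add]; congr 1; ring
  have hu'1 : Valued.v (u' - 1) < Valued.v (2 : M) := by
    rw [hu', show jE u₀ / jE ν₀ - 1 = (jE u₀ - jE ν₀) / jE ν₀ by field_simp, map_div₀, hvν', div_one, ← map_sub, hjE2, ← hj2, hjE2, sq, sq]
    have hlt := hν2
    exact mul_lt_mul'' hlt hlt zero_le zero_le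
  have hlt1 : Valued.v (lam' - 1) < Valued.v (2 : M) := by
    refine hlam'1.trans_lt ?_
    rw [h2Mt, exp_lt_exp]; omega
  have h1lamv : Valued.v (1 + lam') = Valued.v (2 : M) := by
    rw [show 1 + lam' = 2 + (lam' - 1) by ring, Valuation.map_add_eq_of_lt_left _ hlt1]
  have h1uv : Valued.v (1 + u') = Valued.v (2 : M) := by
    rw [show 1 + u' = 2 + (u' - 1) by ring, Valuation.map_add_eq_of_lt_left _ hu'1]
  have h1lam0 : 1 + lam' ≠ 0 := fun h0 => h20M ((Valuation.zero_iff _).1 (by rw [← h1lamv, h0, map_zero]))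
  have h1u0 : 1 + u' ≠ 0 := fun h0 => h20M ((Valuation.zero_iff _).1 (by rw [← h1uv, h0, map_zero]))
  have hlam'0 : lam' ≠ 0 := div_ne_zero hlam0 hjν0
  have hu'0 : u' ≠ 0 := div_ne_zero hju0 hjν0
  have hne' : lam' - u' ≠ 0 := by rw [hlam', hu', ← sub_div]; exact div_ne_zero hμ0 hjν0
  -- ### the S9 element `κ`
  set κ : M := (lam' - u') * (1 + lam') * (1 + u') / (jE s * lam' * u') with hκdef
  have hΘκ : Θ κ = κ := theta_map_signKappa hlamΘ' hu1' hΘω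
  have hκ0 : κ ≠ 0 := by
    rw [hκdef]
    exact div_ne_zero (mul_ne_zero (mul_ne_zero hne' h1lam0) h1u0) (mul_ne_zero (mul_ne_zero hω0 hlam'0) hu'0)
  refine ⟨ν₀, s, hνν, hσν, hs0, hσs, hρν, hνΘ, hdetν, hρω, hΘω, hω0, hjν0, hlam'1, h1lam0, h1u0, hne', ?_⟩
  -- ## `N ∈ L⁺_v` with `jE (ι N) = κρκ`, and `(N, θ)_v = 1 ↔ κρκ ∈ N_{E∕F}`
  have hρN : ρ (κ * ρ κ) = κ * ρ κ := by rw [map_mul, hρρ, mul_comm]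
  have hΘN : Θ (κ * ρ κ) = κ * ρ κ := by rw [map_mul, hΘρ, hΘκ]
  have hρκ0 : ρ κ ≠ 0 := (map_ne_zero ρ).2 hκ0
  have hNM0 : κ * ρ κ ≠ 0 := mul_ne_zero hκ0 hρκ0
  obtain ⟨cN, hcN⟩ := (hjfix _).1 hρN
  have hσcN : σ cN = cN := jE.injective (by rw [← hΘj, hcN, hΘN])
  obtain ⟨N, hN⟩ := exists_toPlace_eq_of_fixed L w hw cN hσcN
  have hN0 : N ≠ 0 := by
    intro h0
    rw [h0, map_zero] at hN
    rw [← hN, map_zero] at hcN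
    exact hNM0 hcN.symm
  have hNiff : hilbertSymbol (v.adicCompletion ↥(maximalRealSubfield L)) N θv = 1 ↔ ∃ e : M, ρ e = e ∧ e * Θ e = κ * ρ κ := by
    rw [hilbertSymbol_eq_one_iff_exists_norm_toPlace L v w hw hN0]
    constructor
    · rintro ⟨z, hz⟩
      refine ⟨jE z, (hjfix _).2 ⟨z, rfl⟩, ?_⟩
      rw [hΘj, ← map_mul, mul_comm, hz, hN, hcN]
    · rintro ⟨e, hρe, he⟩
      obtain ⟨a, rfl⟩ := (hjfix e).1 hρe
      refine ⟨a, jE.injective ?_⟩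
      rw [map_mul, ← hΘj, mul_comm, he, ← hcN, hN]
  rw [← hNiff]
  -- ## it remains: `(β, θ)_v = (N, θ)_v`
  suffices hβN : hilbertSymbol (v.adicCompletion ↥(maximalRealSubfield L)) β θv =
      hilbertSymbol (v.adicCompletion ↥(maximalRealSubfield L)) N θv by rw [hβN]
  have hΘlam' : Θ lam' = lam'⁻¹ := eq_inv_of_mul_eq_one_right hlamΘ'
  have hρlam' : ρ lam' = lam'⁻¹ := eq_inv_of_mul_eq_one_right hlamρ'
  have hΘu'' : Θ u' = u'⁻¹ := eq_inv_of_mul_eq_one_right hu1'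
  have hσu₀' : σ u₀ = u₀⁻¹ := eq_inv_of_mul_eq_one_left hσu₀
  have hσν' : σ ν₀ = ν₀⁻¹ := eq_inv_of_mul_eq_one_left hσν
  have hχ0 : χ ≠ 0 := by rw [hχ, sq]; exact hirr u₀
  -- ## the depth letter `x`: `ι x = −χ∕(u₀ν₀)`, `jE (ι x) = (λ′ + ρλ′) − (u′ + Θu′)`
  set x' : M := (lam' + ρ lam') - (u' + Θ u') with hx'
  have hjx : jE (-χ / (u₀ * ν₀)) = x' := by
    have htr : jE tr = lam + ρ lam := by rw [hρlam]; ring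
    have hjD : jE D = jE ν₀ * jE ν₀ := by rw [← map_mul, hνν]
    have e1 : jE (-χ / (u₀ * ν₀)) = -(jE u₀ ^ 2 - jE tr * jE u₀ + jE D) / (jE u₀ * jE ν₀) := by
      rw [hχ, map_div₀, map_neg, map_add, map_sub, map_pow, map_mul, map_mul]
    rw [e1, htr, hjD, hx', hlam', hu']
    simp only [map_div₀, hρν, hΘj, hσu₀', hσν', map_inv₀]
    field_simp
    ring
  have hΘx' : Θ x' = x' := by
    rw [hx', map_sub, map_add, map_add, hΘlam', ← hρΘ, hΘlam', map_inv₀, hρlam', inv_inv, hΘΘ, hΘu'']; ring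
  have hσx : σ (-χ / (u₀ * ν₀)) = -χ / (u₀ * ν₀) := jE.injective (by rw [← hΘj, hjx, hΘx'])
  obtain ⟨x, hx⟩ := exists_toPlace_eq_of_fixed L w hw _ hσx
  -- ## `(β, θ)_v = (x, θ)_v` (★ p857924 §1 at `u := u₀`, `δ := ν₀`, `n := m − tE`; E-side, type-free)
  have hdeep : Valued.v (u₀ / ν₀ - 1) ≤ Valued.v ϖ ^ (m - tE) := by
    rw [show u₀ / ν₀ - 1 = (u₀ - ν₀) / ν₀ by field_simp, map_div₀, hvν, div_one, hπ]
    refine hν1.trans_eq ?_; congr 1; omega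
  have hβx := hilbertSymbol_token_eq_hilbertSymbol_depth L w hw ϖ d tE hD hσu₀ hνν hσν hχ0 (n := m - tE) (by omega) (by omega) hdeep hβ hx
  rw [hβx]
  -- ## `N₁`: `jE (ι N₁) = (1 + λ′)(1 + ρλ′)`, `|ι(N₁∕4) − 1|_w ≤ |ϖ|^{m − 3tE}`, so `(N₁, θ)_v = 1`
  set N₁' : M := (1 + lam') * (1 + ρ lam') with hN₁'
  have hρN₁ : ρ N₁' = N₁' := by rw [hN₁', map_mul, map_add, map_add, map_one, hρρ]; ring
  have hΘN₁ : Θ N₁' = N₁' := by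
    rw [hN₁', map_mul, map_add, map_add, map_one, hΘlam', ← hρΘ, hΘlam', map_inv₀, hρlam', inv_inv]; ring
  obtain ⟨c₁, hc₁⟩ := (hjfix _).1 hρN₁
  have hσc₁ : σ c₁ = c₁ := jE.injective (by rw [← hΘj, hc₁, hΘN₁])
  obtain ⟨N₁, hN₁⟩ := exists_toPlace_eq_of_fixed L w hw c₁ hσc₁
  have hN₁4 : N₁' - 4 = (lam' - 1) + ρ (lam' - 1) := by
    rw [hN₁', map_sub, map_one]
    linear_combination hlamρ'
  have hvN₁4 : Valued.v (N₁' - 4) ≤ exp (-(2 * ((m : ℤ) - tE))) := by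
    rw [hN₁4]
    refine (Valuation.map_add _ _ _).trans (max_le hlam'1 ?_)
    rw [hvρ]; exact hlam'1
  -- the square root: `|c₁ − 4|_w ≤ exp(−(m − tE))`
  have hvc₁4 : Valued.v (c₁ - 4) ≤ exp (-((m : ℤ) - tE)) := by
    apply le_exp_of_mul_self_le
    rw [← sq, ← hjE2, map_sub, hc₁, map_ofNat]
    refine hvN₁4.trans_eq ?_; congr 1; ring
  have h4w : Valued.v (4 : w.1.adicCompletion L) = exp (-(2 * (tE : ℤ))) := by
    rw [show (4 : w.1.adicCompletion L) = 2 * 2 by norm_num, Valuation.map_mul, h2t, ← exp_add]; ring_nf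
  have h40 : (4 : w.1.adicCompletion L) ≠ 0 := fun h0 => by rw [h0, map_zero] at h4w; exact (exp_ne_zero h4w.symm).elim
  have h40v : (4 : v.adicCompletion ↥(maximalRealSubfield L)) ≠ 0 := by
    intro h0; apply h40; rw [← map_ofNat (toPlace v w) 4, h0, map_zero]
  have hyv : Valued.v (toPlace v w (N₁ / 4) - 1) ≤ Valued.v ϖ ^ (m - 3 * tE) := by
    have h1 : toPlace v w (N₁ / 4) - 1 = (c₁ - 4) / 4 := by rw [map_div₀, map_ofNat, hN₁]; field_simp
    rw [h1, map_div₀, h4w, hπ, div_eq_mul_inv, ← exp_neg, neg_neg]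
    calc Valued.v (c₁ - 4) * exp (2 * (tE : ℤ)) ≤ exp (-((m : ℤ) - tE)) * exp (2 * (tE : ℤ)) := by gcongr
      _ = exp (-((m - 3 * tE : ℕ) : ℤ)) := by rw [← exp_add]; congr 1; omega
  have hy1 : hilbertSymbol (v.adicCompletion ↥(maximalRealSubfield L)) (N₁ / 4) θv = 1 :=
    hilbertSymbol_eq_one_of_valued_toPlace_sub_one_le L w hw ϖ d tE hD (N := m - 3 * tE) (by omega) hyv
  have hN₁v : Valued.v N₁' = Valued.v (2 : M) * Valued.v (2 : M) := by
    rw [hN₁', Valuation.map_mul, h1lamv, show 1 + ρ lam' = ρ (1 + lam') by rw [map_add, map_one], hvρ, h1lamv]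
  have hN₁0 : N₁ ≠ 0 := by
    intro h0
    rw [h0, map_zero] at hN₁
    rw [← hN₁, map_zero] at hc₁
    rw [← hc₁, map_zero] at hN₁v
    exact mul_ne_zero ((Valuation.ne_zero_iff _).2 h20M) ((Valuation.ne_zero_iff _).2 h20M) hN₁v.symm
  have hy0 : N₁ / 4 ≠ 0 := div_ne_zero hN₁0 h40v
  have hN₁θ : hilbertSymbol (v.adicCompletion ↥(maximalRealSubfield L)) N₁ θv = 1 := by
    rw [show N₁ = 4 * (N₁ / 4) by field_simp, hilbertSymbol_adicCompletion_mul_left ↥(maximalRealSubfield L) v h40v hy0 hθ0, hy1, mul_one]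
    exact hilbertSymbol_eq_one_of_isSquare ⟨2, by norm_num⟩ h40v θv
  -- ## `N₂`: `ι N₂ = (1 + u₀′)·σ(1 + u₀′)`, a norm from `L_w`
  set u₀' : w.1.adicCompletion L := u₀ / ν₀ with hu₀'
  have hju' : jE u₀' = u' := by rw [hu₀', hu', map_div₀]
  have hσc₂ : σ ((1 + u₀') * σ (1 + u₀')) = (1 + u₀') * σ (1 + u₀') := by rw [map_mul, hσσ, mul_comm]
  obtain ⟨N₂, hN₂⟩ := exists_toPlace_eq_of_fixed L w hw _ hσc₂
  have hjN₂ : jE (toPlace v w N₂) = (1 + u') * (1 + Θ u') := by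
    rw [hN₂, map_mul, ← hΘj, map_add, map_one, hju', map_add, map_one]
  have hN₂v : Valued.v ((1 + u') * (1 + Θ u')) = Valued.v (2 : M) * Valued.v (2 : M) := by
    rw [Valuation.map_mul, h1uv, show 1 + Θ u' = Θ (1 + u') by rw [map_add, map_one], hvΘ, h1uv]
  have hN₂0 : N₂ ≠ 0 := by
    intro h0
    rw [h0, map_zero, map_zero] at hjN₂
    rw [← hjN₂] at hN₂v
    rw [map_zero] at hN₂v
    exact mul_ne_zero ((Valuation.ne_zero_iff _).2 h20M) ((Valuation.ne_zero_iff _).2 h20M) hN₂v.symm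
  have hN₂θ : hilbertSymbol (v.adicCompletion ↥(maximalRealSubfield L)) N₂ θv = 1 :=
    (hilbertSymbol_eq_one_iff_exists_norm_toPlace L v w hw hN₂0).2 ⟨1 + u₀', by rw [hN₂, mul_comm]⟩
  -- ## the identity `x·N₁·N₂ = −θ·N` in `L⁺_v` (★ p857819 §2 pulled back along `jE ∘ ι`)
  have hS9 := traceDiff_mul_norms_eq_neg_sq_mul_norm_signKappa hlamρ' hρu' hu1' hρω hω0
  have hident : x * N₁ * N₂ = -(θv * N) := by
    apply hjι
    change jE (toPlace v w (x * N₁ * N₂)) = jE (toPlace v w (-(θv * N)))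
    rw [map_mul, map_mul, map_mul, map_mul, hx, hjx, hN₁, hc₁, hjN₂, map_neg, map_mul, map_neg, map_mul, hN, hcN, ← hs2,
      map_pow, hx', hN₁']
    rw [hκdef]
    exact hS9
  have hx'0 : x' ≠ 0 := by
    intro h0
    have h1 := hS9
    rw [← hx', h0, zero_mul, zero_mul] at h1
    exact mul_ne_zero (pow_ne_zero 2 hω0) hNM0 (neg_eq_zero.1 h1.symm)
  have hx0 : x ≠ 0 := by
    intro h0
    rw [h0, map_zero] at hx
    rw [← hx, map_zero] at hjx
    exact hx'0 hjx.symm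
  exact hilbertSymbol_eq_of_mul_mul_eq_neg_mul L (v := v) hx0 hN₁0 hN₂0 hN0 hθ0 hident hN₁θ hN₂θ

end Summit.HodgeConjecture.HodgeConjecture.Cruxes.H413.F0P3cDyRamSignSymbolRamM

end
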